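import Summits.AnomalousDissipation.AnomalousDissipation.Theorems.TaylorCertificatesKolmogorovFloorAssemblyLattice
import Literature.Analysis.FunctionSpaces.TorusTrigPoly
import Literature.Analysis.FunctionSpaces.TorusWeightedGalerkinCoefficients

/-!
# ASSEMBLY of line `Sketch` (digit-frame-closure), part 2: the lattice response coefficients
(crux stmt-AnomalousDissipation-15122, negative side of `TaylorCertificates.KolmogorovFloor`; line lead)

Properties of `respCoeff` that follow from PER-LINE hypotheses (conclusions of the LINE-ALGEBRA stub taken as assumptions on
each forced mode): value at a line site, vanishing off the line sites / at the origin / on the `L`-ball / off the synthesis ball,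
conjugate symmetry, transversality, and `ℓ¹`-type bounds through the double sum.
-/

noncomputable section

set_option linter.dupNamespace false

open Matrix Finset UnitAddTorus MeasureTheory
open scoped BigOperators ComplexConjugate InnerProductSpace ENNReal

namespace Summit.AnomalousDissipation.AnomalousDissipation.Theorems.KolmogorovFloor.Response

open Literature.Analysis.FunctionSpaces Literature.Analysis.FluidPDE

/-! ### Membership facts for the forced modes and the odd window -/

/-- A forced mode is a nonzero lattice point with `k·k ≤ L²`. -/
theorem mem_forcedModes {L : ℕ} {k : Fin 3 → ℤ} :
    k ∈ forcedModes L ↔ k ≠ 0 ∧ k ⬝ᵥ k ≤ (L : ℤ) ^ 2 := by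
  rw [forcedModes, Finset.mem_erase, Torus.mem_freqBall, freqNormSq_eq_dotProduct]
  constructor
  · rintro ⟨h0, h⟩; exact ⟨h0, by exact_mod_cast h⟩
  · rintro ⟨h0, h⟩; exact ⟨h0, by exact_mod_cast h⟩

/-- The forced modes are symmetric under `k ↦ −k`. -/
theorem neg_mem_forcedModes {L : ℕ} {k : Fin 3 → ℤ} (hk : k ∈ forcedModes L) : -k ∈ forcedModes L := by
  rw [mem_forcedModes] at hk ⊢
  exact ⟨neg_ne_zero.2 hk.1, by simpa [neg_dotProduct, dotProduct_neg] using hk.2⟩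

/-- The odd window is symmetric under `m ↦ −m`. -/
theorem neg_mem_oddWindow {J : ℕ} {m : ℤ} (hm : m ∈ oddWindow J) : -m ∈ oddWindow J := by
  rw [mem_oddWindow] at hm ⊢
  exact ⟨by omega, by rw [abs_neg]; exact hm.2⟩

/-- Members of the odd window are odd. -/
theorem odd_of_mem_oddWindow {J : ℕ} {m : ℤ} (hm : m ∈ oddWindow J) : m % 2 = 1 := (mem_oddWindow.1 hm).1

/-- Members of the odd window are nonzero. -/
theorem ne_zero_of_mem_oddWindow {J : ℕ} {m : ℤ} (hm : m ∈ oddWindow J) : m ≠ 0 := by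
  have := odd_of_mem_oddWindow hm; omega

/-! ### Double sums of line-site indicators -/

/-- **Exchange of a lattice sum with the line-site indicators**: summing `[κ = k + mξ] G κ k m` over `κ ∈ S` leaves
`[k + mξ ∈ S] G (k + mξ) k m`. -/
theorem sum_lineSite_indicator {M : Type*} [AddCommMonoid M] (S : Finset (Fin 3 → ℤ)) (K : Finset (Fin 3 → ℤ))
    (W : Finset ℤ) (ξ : Fin 3 → ℤ) (G : (Fin 3 → ℤ) → (Fin 3 → ℤ) → ℤ → M) :
    ∑ κ ∈ S, ∑ k ∈ K, ∑ m ∈ W, (if κ = k + m • ξ then G κ k m else 0) =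
      ∑ k ∈ K, ∑ m ∈ W, (if k + m • ξ ∈ S then G (k + m • ξ) k m else 0) := by
  rw [Finset.sum_comm]
  refine Finset.sum_congr rfl fun k _ => ?_
  rw [Finset.sum_comm]
  refine Finset.sum_congr rfl fun m _ => ?_
  rw [Finset.sum_ite_eq' S (k + m • ξ) (fun κ => G κ k m)]

/-- Consequence for nonnegative real weights: the lattice sum of the indicator-weighted sizes is at most the full
double sum. -/
theorem sum_lineSite_indicator_le (S : Finset (Fin 3 → ℤ)) (K : Finset (Fin 3 → ℤ)) (W : Finset ℤ)
    (ξ : Fin 3 → ℤ) (G : (Fin 3 → ℤ) → (Fin 3 → ℤ) → ℤ → ℝ) (hG : ∀ κ k m, 0 ≤ G κ k m) :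
    ∑ κ ∈ S, ∑ k ∈ K, ∑ m ∈ W, (if κ = k + m • ξ then G κ k m else 0) ≤
      ∑ k ∈ K, ∑ m ∈ W, G (k + m • ξ) k m := by
  rw [sum_lineSite_indicator]
  refine Finset.sum_le_sum fun k _ => Finset.sum_le_sum fun m _ => ?_
  split_ifs
  · exact le_rfl
  · exact hG _ _ _

/-! ### Values of `respCoeff` -/

section Values

variable (L : ℕ) (ξ e : Fin 3 → ℤ) (g : (Fin 3 → ℤ) → EuclideanSpace ℂ (Fin 3)) (J : ℕ)

/-- Off the line sites of the forced modes the response coefficient vanishes. -/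
theorem respCoeff_eq_zero_of_ne {κ : Fin 3 → ℤ}
    (h : ∀ k ∈ forcedModes L, ∀ m ∈ oddWindow J, κ ≠ k + m • ξ) : respCoeff L ξ e g J κ = 0 := by
  rw [respCoeff]
  refine Finset.sum_eq_zero fun k hk => Finset.sum_eq_zero fun m hm => ?_
  rw [if_neg (h k hk m hm)]

/-- **The response coefficient at a line site** `k₀ + m₀ξ` of a forced mode is the line coefficient `c^{(k₀)}_{m₀}`
(injectivity of the line sites on small modes: `4L² < ξ·ξ`). -/
theorem respCoeff_lineSite (hX : 4 * (L : ℤ) ^ 2 < ξ ⬝ᵥ ξ) {k₀ : Fin 3 → ℤ} (hk₀ : k₀ ∈ forcedModes L)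
    {m₀ : ℤ} (hm₀ : m₀ ∈ oddWindow J) :
    respCoeff L ξ e g J (k₀ + m₀ • ξ) = lineCoeff ξ e k₀ (g k₀) J m₀ := by
  rw [respCoeff]
  have hK0 := (mem_forcedModes.1 hk₀).2
  rw [Finset.sum_eq_single_of_mem k₀ hk₀]
  · rw [Finset.sum_eq_single_of_mem m₀ hm₀]
    · rw [if_pos rfl]
    · intro m _ hm
      rw [if_neg]
      intro h
      exact hm ((lineSite_inj hK0 hK0 hX h).1).symm
  · intro k hk hne
    refine Finset.sum_eq_zero fun m _ => ?_
    rw [if_neg]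
    intro h
    exact hne ((lineSite_inj hK0 (mem_forcedModes.1 hk).2 hX h).2).symm

/-- The response coefficient vanishes at the origin (`L² < ξ·ξ`). -/
theorem respCoeff_zero (hX : (L : ℤ) ^ 2 < ξ ⬝ᵥ ξ) : respCoeff L ξ e g J 0 = 0 := by
  refine respCoeff_eq_zero_of_ne L ξ e g J fun k hk m hm h => ?_
  have hk' := mem_forcedModes.1 hk
  exact lineSite_ne_zero (hk'.2.trans_lt hX) (odd_of_mem_oddWindow hm) h.symm

/-- The response has no modes in the `L`-ball, provided every line site of a forced mode lies outside it. -/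
theorem respCoeff_zero_of_mem_ball {κ : Fin 3 → ℤ}
    (hN : ∀ k ∈ forcedModes L, ∀ m ∈ oddWindow J, (L : ℝ) ^ 2 < Torus.freqNormSq (k + m • ξ))
    (hκ : κ ∈ Torus.freqBall L) : respCoeff L ξ e g J κ = 0 := by
  refine respCoeff_eq_zero_of_ne L ξ e g J fun k hk m hm h => ?_
  have h1 := Torus.mem_freqBall.1 hκ
  rw [h] at h1
  exact absurd (hN k hk m hm) (not_lt.2 h1)

/-- The response has no modes outside the synthesis ball of radius `R`, provided every line site of a forced mode
lies inside it. -/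
theorem respCoeff_zero_of_not_mem_ball {R : ℕ} {κ : Fin 3 → ℤ}
    (hN : ∀ k ∈ forcedModes L, ∀ m ∈ oddWindow J, Torus.freqNormSq (k + m • ξ) ≤ (R : ℝ) ^ 2)
    (hκ : κ ∉ Torus.freqBall R) : respCoeff L ξ e g J κ = 0 := by
  refine respCoeff_eq_zero_of_ne L ξ e g J fun k hk m hm h => ?_
  have h1 := Torus.not_mem_freqBall.1 hκ
  rw [h] at h1
  exact absurd (hN k hk m hm) (not_le.2 h1)

/-- **Conjugate symmetry of the response coefficients** from the conjugate symmetry of the force coefficients and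
the symmetry of the scalar line sequences under `(a, c, s, v, m) ↦ (−a, −c, −s, conj v, −m)`. -/
theorem isConjSymm_respCoeff (hg : ∀ k ∈ forcedModes L, g (-k) = EuclideanSpace.conjVec (g k))
    (hsym : ∀ k ∈ forcedModes L, ∀ m : ℤ,
      let d := lineData k ξ e
      let F := lineForce ξ e (g k)
      let d' : LineData := ⟨-d.a, -d.c, -d.s, d.K, d.X2, d.e2, d.n2⟩
      let F' : LineForce := ⟨starRingEnd ℂ F.ve, starRingEnd ℂ F.vx, starRingEnd ℂ F.vn⟩
      xC d' F' J m = starRingEnd ℂ (xC d F J (-m)) ∧ yC d' F' J m = starRingEnd ℂ (yC d F J (-m)) ∧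
        zC d' F' J m = starRingEnd ℂ (zC d F J (-m))) :
    Torus.IsConjSymm (respCoeff L ξ e g J) := by
  intro κ
  rw [respCoeff, respCoeff, EuclideanSpace.conjVec_sum]
  -- reindex `k ↦ -k`
  refine Finset.sum_nbij' (fun k => -k) (fun k => -k) (fun k hk => neg_mem_forcedModes hk)
    (fun k hk => neg_mem_forcedModes hk) (fun k _ => neg_neg k) (fun k _ => neg_neg k) fun k hk => ?_
  rw [EuclideanSpace.conjVec_sum]
  -- reindex `m ↦ -m`
  refine Finset.sum_nbij' (fun m => -m) (fun m => -m) (fun m hm => neg_mem_oddWindow hm)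
    (fun m hm => neg_mem_oddWindow hm) (fun m _ => neg_neg m) (fun m _ => neg_neg m) fun m _ => ?_
  have hiff : (-κ = k + m • ξ) ↔ (κ = -k + -m • ξ) := by
    constructor
    · intro h; rw [← neg_neg κ, h, neg_add, neg_smul]
    · intro h; rw [h, neg_add, neg_smul, neg_neg, neg_neg]
  by_cases h : -κ = k + m • ξ
  · rw [if_pos h, if_pos (hiff.1 h)]
    have hk' : -k ∈ forcedModes L := neg_mem_forcedModes hk
    have e1 : g (-k) = EuclideanSpace.conjVec (g k) := hg k hk
    -- the line coefficient of `(-k, g(-k))` at `-m` is the conjugate of that of `(k, g k)` at `m`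
    have e2 := lineCoeff_neg_conjVec (ξ := ξ) (e := e) k (g k) J (hsym k hk) m
    rw [← e1] at e2
    rw [e2, EuclideanSpace.conjVec_conjVec]
  · rw [if_neg h, if_neg (fun h' => h (hiff.2 h')), EuclideanSpace.conjVec_zero]

/-- **Transversality of the response coefficients**: `κ · C(κ) = 0` for every `κ`, from the solenoidality of each
line sequence (`(k + mξ)·c^{(k)}_m = 0`). -/
theorem ipair_respCoeff_eq_zero
    (htr : ∀ k ∈ forcedModes L, ∀ m ∈ oddWindow J, ipair (k + m • ξ) (lineCoeff ξ e k (g k) J m) = 0)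
    (κ : Fin 3 → ℤ) : ipair κ (respCoeff L ξ e g J κ) = 0 := by
  rw [respCoeff, ipair_sum]
  refine Finset.sum_eq_zero fun k hk => ?_
  rw [ipair_sum]
  refine Finset.sum_eq_zero fun m hm => ?_
  rw [ipair_ite]
  split_ifs with h
  · rw [h]; exact htr k hk m hm
  · rfl

/-- Transversality in the library's form `Σᵢ κᵢ C(κ)ᵢ = 0`. -/
theorem sum_mul_respCoeff_eq_zero
    (htr : ∀ k ∈ forcedModes L, ∀ m ∈ oddWindow J, ipair (k + m • ξ) (lineCoeff ξ e k (g k) J m) = 0)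
    (κ : Fin 3 → ℤ) : ∑ i, (κ i : ℂ) * respCoeff L ξ e g J κ i = 0 :=
  ipair_respCoeff_eq_zero L ξ e g J htr κ

/-! ### Sizes of `respCoeff` through the double sum -/

/-- Pointwise: `‖C(κ)‖ ≤ Σ_k Σ_m [κ = k + mξ] ‖c^{(k)}_m‖`. -/
theorem norm_respCoeff_le_indicator (κ : Fin 3 → ℤ) :
    ‖respCoeff L ξ e g J κ‖ ≤
      ∑ k ∈ forcedModes L, ∑ m ∈ oddWindow J, (if κ = k + m • ξ then ‖lineCoeff ξ e k (g k) J m‖ else 0) := by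
  rw [respCoeff]
  refine (norm_sum_le _ _).trans (Finset.sum_le_sum fun k _ => (norm_sum_le _ _).trans
    (Finset.sum_le_sum fun m _ => ?_))
  split_ifs
  · exact le_rfl
  · rw [norm_zero]

/-- Sup bound: `‖C(κ)‖ ≤ Σ_k Σ_m ‖c^{(k)}_m‖`. -/
theorem norm_respCoeff_le (κ : Fin 3 → ℤ) :
    ‖respCoeff L ξ e g J κ‖ ≤ ∑ k ∈ forcedModes L, ∑ m ∈ oddWindow J, ‖lineCoeff ξ e k (g k) J m‖ := by
  refine (norm_respCoeff_le_indicator L ξ e g J κ).trans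
    (Finset.sum_le_sum fun k _ => Finset.sum_le_sum fun m _ => ?_)
  split_ifs
  · exact le_rfl
  · exact norm_nonneg _

/-- **Weighted `ℓ¹` bound**: for a nonnegative weight `w`,
`Σ_{κ∈S} w(κ)‖C(κ)‖ ≤ Σ_k Σ_m w(k + mξ)‖c^{(k)}_m‖`. -/
theorem sum_weight_norm_respCoeff_le (S : Finset (Fin 3 → ℤ)) (w : (Fin 3 → ℤ) → ℝ) (hw : ∀ κ, 0 ≤ w κ) :
    ∑ κ ∈ S, w κ * ‖respCoeff L ξ e g J κ‖ ≤
      ∑ k ∈ forcedModes L, ∑ m ∈ oddWindow J, w (k + m • ξ) * ‖lineCoeff ξ e k (g k) J m‖ := by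
  calc ∑ κ ∈ S, w κ * ‖respCoeff L ξ e g J κ‖
      ≤ ∑ κ ∈ S, ∑ k ∈ forcedModes L, ∑ m ∈ oddWindow J,
          (if κ = k + m • ξ then w κ * ‖lineCoeff ξ e k (g k) J m‖ else 0) := by
        refine Finset.sum_le_sum fun κ _ => ?_
        have h := mul_le_mul_of_nonneg_left (norm_respCoeff_le_indicator L ξ e g J κ) (hw κ)
        rw [Finset.mul_sum] at h
        refine h.trans (le_of_eq (Finset.sum_congr rfl fun k _ => ?_))
        rw [Finset.mul_sum]
        refine Finset.sum_congr rfl fun m _ => ?_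
        split_ifs <;> simp
    _ ≤ _ := sum_lineSite_indicator_le S _ _ ξ (fun κ k m => w κ * ‖lineCoeff ξ e k (g k) J m‖)
          fun κ k m => mul_nonneg (hw κ) (norm_nonneg _)

/-- `ℓ¹` bound: `Σ_{κ∈S} ‖C(κ)‖ ≤ Σ_k Σ_m ‖c^{(k)}_m‖`. -/
theorem sum_norm_respCoeff_le (S : Finset (Fin 3 → ℤ)) :
    ∑ κ ∈ S, ‖respCoeff L ξ e g J κ‖ ≤ ∑ k ∈ forcedModes L, ∑ m ∈ oddWindow J, ‖lineCoeff ξ e k (g k) J m‖ := by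
  have h := sum_weight_norm_respCoeff_le L ξ e g J S (fun _ => 1) fun _ => zero_le_one
  simpa using h

end Values

/-- For nonnegative reals, `Σ xᵢ² ≤ (Σ xᵢ)²`. -/
theorem sum_sq_le_sq_sum {ι : Type*} (s : Finset ι) (x : ι → ℝ) (hx : ∀ i ∈ s, 0 ≤ x i) :
    ∑ i ∈ s, x i ^ 2 ≤ (∑ i ∈ s, x i) ^ 2 := by
  classical
  induction s using Finset.induction_on with
  | empty => simp
  | insert a s ha ih =>
    rw [Finset.sum_insert ha, Finset.sum_insert ha]
    have h0 : 0 ≤ x a := hx a (Finset.mem_insert_self a s)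
    have h1 : 0 ≤ ∑ i ∈ s, x i := Finset.sum_nonneg fun i hi => hx i (Finset.mem_insert_of_mem hi)
    have h2 := ih fun i hi => hx i (Finset.mem_insert_of_mem hi)
    nlinarith

end Summit.AnomalousDissipation.AnomalousDissipation.Theorems.KolmogorovFloor.Response
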